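import Literature.AlgebraicGeometry.Pohlmann1968.CMTypeRankCharactersNumberField
import Literature.AlgebraicGeometry.ComplexMultiplication.PrimitiveCMTypeSimple
import Literature.NumberTheory.Automorphic.PicardCMUniverse
import HarnessLib

/-!
# Transport of the Kubota rank and of nondegeneracy along a field isomorphism

COR-CM (cell `pub-hodgecm2`), binder seat b04 (gen 21), count-neutral utility for the ALL-TYPES programme (the missing
plumbing named in `A7-JUNCTION.md`: with it, lit-hodgefound's `exists_primitive_core` — whose core field `K₁` is an
abstract intermediate field — can be fed theorems stated for a field isomorphic to `K₁`).  KERNEL ONLY: theorems; no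
definition, no named fact, no `sorry`.  `HC_CM` is neither used nor claimed.

For a field isomorphism `e : K ≃+* K'` of number fields, the tree's `cmTypeMap e Φ = {σ : K' → ℂ | σ ∘ e ∈ Φ}`
(`PicardCMUniverse`) carries CM types of `K` to CM types of `K'`; precomposition `σ ↦ σ ∘ e` is a bijection
`Hom(K', ℂ) ≃ Hom(K, ℂ)` commuting with the `Aut(ℂ)`-action, so Kubota's rank (the tree's `typeRank_eq_of_equiv`) and
nondegeneracy are invariant: `cmTypeRank_cmTypeMap`, **`isNondegenerate_cmTypeMap_iff`**; and primitivity: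
`isPrimitive_cmTypeMap_iff`.

## References

* [Kubota1965] T. Kubota, *On the field extension by complex multiplication*, Trans. AMS 118 (1965), §2 (p. 115).
* [Shimura1998] G. Shimura, *Abelian Varieties with Complex Multiplication and Modular Functions*, §8.2 Prop. 26.
-/

noncomputable section

open NumberField

namespace Summit.HodgeConjecture.CorCM.CMTypeTransport

open Literature.NumberTheory.ComplexMultiplication
open Literature.AlgebraicGeometry.Motives (CMType)
open Literature.AlgebraicGeometry.Pohlmann1968
open Literature.NumberTheory.Automorphic.PicardCM.CMCode (cmTypeMap mem_cmTypeMap_iff)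

variable {K K' : Type} [Field K] [NumberField K] [Field K'] [NumberField K']

omit [NumberField K] [NumberField K'] in
/-- `(τ ∘ e⁻¹) ∘ e = τ`. [folklore] -/
theorem comp_symm_comp (e : K ≃+* K') (τ : K →+* ℂ) :
    (τ.comp e.symm.toRingHom).comp e.toRingHom = τ := by
  refine RingHom.ext fun x => ?_
  simp

omit [NumberField K] [NumberField K'] in
/-- `(σ ∘ e) ∘ e⁻¹ = σ`. [folklore] -/
theorem comp_comp_symm (e : K ≃+* K') (σ : K' →+* ℂ) :
    (σ.comp e.toRingHom).comp e.symm.toRingHom = σ := by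
  refine RingHom.ext fun x => ?_
  simp

omit [NumberField K] [NumberField K'] in
/-- The `Aut(ℂ)`-action commutes with precomposition: `g • (σ ∘ e) = (g • σ) ∘ e`. [folklore] -/
theorem smul_comp_toRingHom (e : K ≃+* K') (g : ℂ ≃+* ℂ) (σ : K' →+* ℂ) :
    g • σ.comp e.toRingHom = (g • σ).comp e.toRingHom := by
  rw [ringEquiv_smul_def, ringEquiv_smul_def, RingHom.comp_assoc]

omit [NumberField K] [NumberField K'] in
/-- **The Kubota rank is invariant under field isomorphisms**: `rank(cmTypeMap e Φ) = rank(Φ)`.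
[cite: Kubota1965, §2 (p. 115)] -/
theorem cmTypeRank_cmTypeMap (e : K ≃+* K') (Φ : CMType K) : cmTypeRank (cmTypeMap e Φ) = cmTypeRank Φ := by
  -- precomposition with `e`, a bijection `Hom(K', ℂ) ≃ Hom(K, ℂ)` commuting with `Aut(ℂ)`
  let ε : (K' →+* ℂ) ≃ (K →+* ℂ) :=
    ⟨fun σ => σ.comp e.toRingHom, fun τ => τ.comp e.symm.toRingHom, comp_comp_symm e, comp_symm_comp e⟩
  have hε : ∀ σ, ε σ = σ.comp e.toRingHom := fun σ => rfl
  have hpre : ε ⁻¹' Φ.1 = (cmTypeMap e Φ).1 := by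
    ext σ
    rw [Set.mem_preimage, hε, mem_cmTypeMap_iff]
  rw [cmTypeRank, cmTypeRank, ← hpre]
  refine (typeRank_eq_of_equiv (G := ℂ ≃+* ℂ) (G' := ℂ ≃+* ℂ) ε Φ.1 (fun g => ⟨g, fun σ => ?_⟩)
    (fun g => ⟨g, fun σ => ?_⟩)).symm
  · show g • σ.comp e.toRingHom ∈ Φ.1 ↔ (g • σ).comp e.toRingHom ∈ Φ.1
    rw [smul_comp_toRingHom]
  · show g • σ.comp e.toRingHom ∈ Φ.1 ↔ (g • σ).comp e.toRingHom ∈ Φ.1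
    rw [smul_comp_toRingHom]

/-- `[K' : ℚ] = [K : ℚ]` along a field isomorphism. [folklore] -/
theorem finrank_eq_of_ringEquiv (e : K ≃+* K') : Module.finrank ℚ K' = Module.finrank ℚ K :=
  ((AlgEquiv.ofRingEquiv (f := e) fun q => by simp).toLinearEquiv.finrank_eq).symm

/-- **Nondegeneracy is invariant under field isomorphisms**: `cmTypeMap e Φ` is nondegenerate iff `Φ` is.
[cite: Kubota1965, §2 (p. 115)] -/
theorem isNondegenerate_cmTypeMap_iff (e : K ≃+* K') (Φ : CMType K) :
    IsNondegenerate (cmTypeMap e Φ) ↔ IsNondegenerate Φ := by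
  rw [isNondegenerate_iff, isNondegenerate_iff, cmTypeRank_cmTypeMap, finrank_eq_of_ringEquiv e]

omit [NumberField K] [NumberField K'] in
/-- The inverse direction: `Φ' = cmTypeMap e Φ` for `Φ = cmTypeMap e.symm Φ'`. [folklore] -/
theorem cmTypeMap_cmTypeMap_symm (e : K ≃+* K') (Φ' : CMType K') : cmTypeMap e (cmTypeMap e.symm Φ') = Φ' := by
  apply Subtype.ext
  ext σ
  rw [mem_cmTypeMap_iff, mem_cmTypeMap_iff, comp_comp_symm]

/-- Hence every CM type of `K'` is nondegenerate iff every CM type of `K` is. [cite: Kubota1965, §2 (p. 115)] -/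
theorem forall_isNondegenerate_iff_of_ringEquiv (e : K ≃+* K') :
    (∀ Φ' : CMType K', IsNondegenerate Φ') ↔ ∀ Φ : CMType K, IsNondegenerate Φ := by
  constructor
  · intro h Φ
    exact (isNondegenerate_cmTypeMap_iff e Φ).1 (h _)
  · intro h Φ'
    rw [← cmTypeMap_cmTypeMap_symm e Φ']
    exact (isNondegenerate_cmTypeMap_iff e _).2 (h _)

omit [NumberField K] [NumberField K'] in
/-- **Primitivity (separation form) is invariant under field isomorphisms.** [cite: Shimura1998, §8.2 Prop. 26] -/
theorem primitive_cmTypeMap_iff (e : K ≃+* K') (Φ : CMType K) :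
    (∀ s t : K' →+* ℂ,
        (∀ τ : ℂ ≃+* ℂ, (τ : ℂ →+* ℂ).comp s ∈ (cmTypeMap e Φ).1 ↔ (τ : ℂ →+* ℂ).comp t ∈ (cmTypeMap e Φ).1) →
          s = t) ↔
      ∀ s t : K →+* ℂ, (∀ τ : ℂ ≃+* ℂ, (τ : ℂ →+* ℂ).comp s ∈ Φ.1 ↔ (τ : ℂ →+* ℂ).comp t ∈ Φ.1) → s = t := by
  constructor
  · intro h s t hst
    have h' := h (s.comp e.symm.toRingHom) (t.comp e.symm.toRingHom) fun τ => by
      rw [mem_cmTypeMap_iff, mem_cmTypeMap_iff, RingHom.comp_assoc, comp_symm_comp, RingHom.comp_assoc,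
        comp_symm_comp]
      exact hst τ
    rw [← comp_symm_comp e s, ← comp_symm_comp e t, h']
  · intro h s t hst
    have h' := h (s.comp e.toRingHom) (t.comp e.toRingHom) fun τ => by
      have := hst τ
      rwa [mem_cmTypeMap_iff, mem_cmTypeMap_iff, RingHom.comp_assoc, RingHom.comp_assoc] at this
    rw [← comp_comp_symm e s, ← comp_comp_symm e t, h']

/-- **Primitivity (`Aut(ℂ)`-form) is invariant under field isomorphisms**, at the base points `φ₀ ∘ e⁻¹` and `φ₀`.
[cite: Shimura1998, §8.2 Prop. 26] -/
theorem isPrimitive_cmTypeMap_iff (e : K ≃+* K') (Φ : CMType K) (φ₀ : K →+* ℂ) :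
    IsPrimitive (ℂ ≃+* ℂ) (cmTypeMap e Φ).1 (φ₀.comp e.symm.toRingHom) ↔ IsPrimitive (ℂ ≃+* ℂ) Φ.1 φ₀ := by
  rw [Literature.AlgebraicGeometry.ComplexMultiplication.isPrimitive_ringEquiv_complex_iff,
    Literature.AlgebraicGeometry.ComplexMultiplication.isPrimitive_ringEquiv_complex_iff, primitive_cmTypeMap_iff]

end Summit.HodgeConjecture.CorCM.CMTypeTransport

end
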